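import Summits.ResolutionOfSingularities.ResolutionOfSingularities.Theorems.StallVertexDeficiencyLaw
import HarnessLib

/-!
# StallVertexFlatClasses — decomp-res node «StallVertex» (lens-5 g22 rev 7/8), add-on tree file 20 of the node

Content VERBATIM from the decomp-res lens-5 file `HOME/decomp-res-lens-5/g22/StallVertex.lean` rev 8 (pin 9799ca34,
4 539 l; rev 8 = rev 7 25c16fe6 +
five pure insertions §1j/§1k/§2d/§3i/§4i/§4j; rev 7 = pure insertions §2c/§4h over the landed rev-6 content
95ed6f6f — all earlier statements
byte-identical (critic machine diffs, CRITIC-LEDGER rows 142g / 142h); HOME = run/shared/lean/pub/decomp-res).  The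
rev-0…6 sections are ALREADY in the
tree (`StallVertexForms` / `Kernels` / `Walk` / `Classes` / `Clean` / `Rigid` / `Lines` / `RigidClasses` / `Carry` /
`OldLetter` / `LineTurn` /
`LetterClasses` / `Regime` / `StraightClasses` + wiring `MaxContactCutStallVertex` /
`MaxContactCutStallVertexEvents`, writer g7/g8); the rev-7/8 add-on
files carry ONLY the 53 declarations NEW in rev 7 / rev 8.  Critic: CRITIC-LEDGER row 142g (rev 7, DECIDED +1 (Y):
THE DEFICIENCY LAW — the positive
young-monomial regime is EMPTY, positive differential shade is an interference phenomenon, exact re-location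
`monomialRegime_iff_flat`; inhabitants
T-regime 3 353/116; 2026-08-30T23:43:05Z) and row 142h (rev 8, BOOKED 0: RESONANCE / ECHO / NULL / COINCIDENCE laws
+ the exact two-leaf split
`defectWalksDeep_iff_positive_nullFlat`; 2026-08-31T00:03:14Z) — landing orders INBOX :525 / :543.  Landed by
decomp-res writer g9 as
`StallVertexEcho` (§1j + §1k + §3i), `StallVertexDeficiency` (§2c + §2d), `StallVertexDeficiencyLaw` (§4h
kernels: `FlatMonomialAt` … `muTilde_eq_zero_of_regime`),
`StallVertexFlatClasses` (§4h cells and exact re-locations), `StallVertexNullClasses` (§4i + §4j cells and exact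
re-locations) and the wiring file
`MaxContactCutStallVertexFlat` (every new `closes_…` / `defectWalksDeep_iff_…` BY NAME on
`MaxContactCut.DefectWalksDeep`).  All
`--supports stmt-ResolutionOfSingularities-31770`.  Every file of the node is in the Theses cone (the lens imports
the in-cone `DifferentialShade`), so the
located residual is booked on the route by RE-LOCATING the existing aside 28122 `CFNoSkewJointTailsDeep` (informal-only edit) to
`StallVertex.NoFlatRegimeSkewStalledTailsDeep` ≡ `NoPositiveSkewStalledTailsDeep ∧
NoNullFlatSkewStalledTailsDeep` (EXACT, hypothesis-free chain
skew ↔ … ↔ monomialRegime ↔ flat ↔ positive ∧ nullFlat: `skew_iff_flat`, `skew_iff_positive_nullFlat`)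
— one aside on this column (critic rows 142g/142h:
«file only the newest, exactly one aside on the column; decided cells and the μ̃-sign leaves NOT filed»).

§4h part 2 (rev 7, `section Classes`) THE POSITIVE MONOMIAL REGIME IS EMPTY — the cell
`NoPositiveMonomialRegimeSkewStalledTailsDeep` DECIDED
(`noPositiveMonomialRegimeSkewStalledTailsDeep_holds`), positive differential shade is an interference phenomenon
(`unclean_io_of_muTilde_pos`), and
**THE LOCATED RESIDUAL OF THE NODE `NoFlatRegimeSkewStalledTailsDeep`** (interference ∨ the eternal FLAT
young-monomial regime) with `flat_of_monomialRegime` /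
`monomialRegime_of_flat` / EXACT `monomialRegime_iff_flat` / `lineFree_iff_flat` / `skew_iff_flat :
CoefficientCut.NoSkewJointTailsDeep ↔
NoFlatRegimeSkewStalledTailsDeep` (hypothesis-free); the split beneath:
`NoPositiveInterferenceSkewStalledTailsDeep`, `NoNullSkewStalledTailsDeep`,
EXACT `flat_iff_positiveInterference_null`, `NoPositiveSkewStalledTailsDeep`, `positiveInterference_iff_positive`.
0 sorry.  The BY-NAME theorems on
`MaxContactCut.DefectWalksDeep` (`closes_flat`, `defectWalksDeep_iff_flat`) are in `MaxContactCutStallVertexFlat`.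
Imports `StallVertexDeficiencyLaw`.

[WRITER NOTE (decomp-res writer g9): file split only; namespace, opens, section variables and every declaration
exactly as in the lens (global `set_option` dropped; the lens's `set_option maxHeartbeats … in` lines kept; the
lens's private copy `flat_monomial'` of the landed
`Literature.AlgebraicGeometry.Resolution.PointBlowup.flat_monomial` is cited by its full name, as in `StallVertexCarry`).]

(Sources: KawanoueMatsuki2016 Prop. 4 (2), §4.1; Kawanoue2007 Lemma 2.2.1.2; BierstoneGrigorievMilmanWlodarczyk2011
Def. 3.1.3; Hauser2010; HauserPerlega2024; Moh1987; CossartPiltant2008; Giraud1975; Hironaka1964; ZariskiSamuelII Ch. VIII §2.)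
-/

noncomputable section

open MvPolynomial Finset
open Literature.AlgebraicGeometry.Resolution
open Literature.AlgebraicGeometry.Resolution.Hauser2010
open Literature.AlgebraicGeometry.Resolution.HauserPerlega2024
open Literature.Barriers.ResolutionOfSingularities
open Literature.AlgebraicGeometry.Resolution.PointBlowup
open Summit.ResolutionOfSingularities.ResolutionOfSingularities.Theses
open Summit.ResolutionOfSingularities.ResolutionOfSingularities.Theorems.TightDefectClasses
open Summit.ResolutionOfSingularities.ResolutionOfSingularities.Theorems.ProximityCut
open Summit.ResolutionOfSingularities.ResolutionOfSingularities.Theorems.ExitLaw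
open Summit.ResolutionOfSingularities.ResolutionOfSingularities.Theorems.DifferentialShade

namespace Summit.ResolutionOfSingularities.ResolutionOfSingularities.Theorems.StallVertex

section Classes

/-- DECIDED CLASS (h″): **THE POSITIVE MONOMIAL REGIME** — the line-free rigid skew stalled residual's binders
VERBATIM, plus: clean for the minimisers from some `N₁ ≥ N` on, IN THE MONOMIAL REGIME from `N₁` on (a young monomial
cone at every time `≥ N₁`), and of POSITIVE differential shade `μ̃(N) > 0` (Kawanoue–Matsuki's GENERAL case
«`μ̃ > 0`»,
as opposed to their monomial case `μ̃ = 0`).  PROVED EMPTY below by the deficiency law. -/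
def NoPositiveMonomialRegimeSkewStalledTailsDeep : Prop :=
  ∀ p : ℕ, p.Prime → ∀ e : ℕ, 2 ≤ e → ∀ (K : Type) [Field K] [CharP K p] [PerfectField K] [DecidableEq K]
    (s₀ : State (Fin 3) K), IsRoot (p ^ e) s₀ → ∀ W : ForcedWalk (p ^ e) s₀, (∀ i, 1 ≤ (W.st i).shade) →
    ∀ N : ℕ, (∀ t, N ≤ t → (W.st (t + 1)).shade = (W.st t).shade) →
    (∀ t, N ≤ t → ordZero (W.st t).F ≠ ((p ^ e : ℕ) : ℕ∞)) →
    (∀ M : ℕ, ∃ t, M ≤ t ∧ StaysOnNewest W t) → (∀ M : ℕ, ∃ t, M ≤ t ∧ W.b t ≠ 0) →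
    (∀ (k : Fin 3) (N' : ℕ), ∃ t, N' ≤ t ∧ (W.j t = k ∨ W.b t k ≠ 0)) →
    (∀ t, N ≤ t → (ifp W (t + 1)).muTilde (p ^ e) = (ifp W t).muTilde (p ^ e)) →
    (∀ t, N ≤ t → VertexLawEqAt W t) → (∀ t, N ≤ t → OriginLawAt W t) →
    (∀ (s : ℕ) (c : Fin 3 → K), ¬ ContactLineFrom W s c) →
    ∀ N₁ : ℕ, N ≤ N₁ → (∀ t, N₁ ≤ t → CleanAt W t) → (∀ t, N₁ ≤ t → YoungMonomialAt W t) →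
    (0 : WithTop ℚ) < (ifp W N).muTilde (p ^ e) → False

/-- **The positive monomial regime is EMPTY** (kernel, every `q = p^e`, every field of characteristic `p`): in a clean
monomial regime of a skew stalled tail `μ̃ ≡ 0` (`muTilde_eq_zero_of_regime`). [folklore] -/
theorem noPositiveMonomialRegimeSkewStalledTailsDeep_holds : NoPositiveMonomialRegimeSkewStalledTailsDeep := by
  intro p hp e _ K _ _ _ _ s₀ hs W _ N _ _ _ _ hskew hstall _ _ _ N₁ hN₁ hcl hreg hpos
  exact hpos.ne' (muTilde_eq_zero_of_regime hp hs W N N₁ hN₁ hstall hcl (hreg N₁ le_rfl) hskew N le_rfl)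

/-- **POSITIVE DIFFERENTIAL SHADE FORCES INTERFERENCE**: a line-free rigid skew stalled tail with `μ̃(N) > 0` is UNCLEAN
for the minimisers INFINITELY OFTEN.  (Clean from `N₁` on ⟹ either young-free, the empty cell (g″), or a young monomial
appears, the regime is entered for good and `μ̃ ≡ 0`.) [new] [folklore] -/
theorem unclean_io_of_muTilde_pos (p : ℕ) (hp : p.Prime) (e : ℕ) (he : 2 ≤ e) (K : Type) [Field K] [CharP K p]
    [PerfectField K] [DecidableEq K] (s₀ : State (Fin 3) K) (hs : IsRoot (p ^ e) s₀) (W : ForcedWalk (p ^ e) s₀)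
    (hsh : ∀ i, 1 ≤ (W.st i).shade) (N : ℕ) (hplat : ∀ t, N ≤ t → (W.st (t + 1)).shade = (W.st t).shade)
    (hexc : ∀ t, N ≤ t → ordZero (W.st t).F ≠ ((p ^ e : ℕ) : ℕ∞))
    (hS : ∀ M : ℕ, ∃ t, M ≤ t ∧ StaysOnNewest W t) (hT : ∀ M : ℕ, ∃ t, M ≤ t ∧ W.b t ≠ 0)
    (hskew : ∀ (k : Fin 3) (N' : ℕ), ∃ t, N' ≤ t ∧ (W.j t = k ∨ W.b t k ≠ 0))
    (hstall : ∀ t, N ≤ t → (ifp W (t + 1)).muTilde (p ^ e) = (ifp W t).muTilde (p ^ e))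
    (hrig : ∀ t, N ≤ t → VertexLawEqAt W t) (horig : ∀ t, N ≤ t → OriginLawAt W t)
    (hlf : ∀ (s : ℕ) (c : Fin 3 → K), ¬ ContactLineFrom W s c)
    (hpos : (0 : WithTop ℚ) < (ifp W N).muTilde (p ^ e)) :
    ∀ N₁, N ≤ N₁ → ∃ t, N₁ ≤ t ∧ ¬ CleanAt W t := by
  intro N₁ hN₁
  by_contra hcon
  have hcl : ∀ t, N₁ ≤ t → CleanAt W t := fun t ht => by
    by_contra hc
    exact hcon ⟨t, ht, hc⟩
  by_cases hyf : ∃ t, N₁ ≤ t ∧ YoungMonomialAt W t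
  · obtain ⟨t₀, ht₀, hy⟩ := hyf
    exact hpos.ne' (muTilde_eq_zero_of_regime hp hs W N t₀ (le_trans hN₁ ht₀) hstall
      (fun t ht => hcl t (le_trans ht₀ ht)) hy hskew N le_rfl)
  · exact noYoungFreeCleanSkewStalledTailsDeep_holds p hp e he K s₀ hs W hsh N hplat hexc hS hT hskew hstall hrig
      horig hlf N₁ hN₁ hcl fun t ht hy => hyf ⟨t, ht, hy⟩

/-- LOCATED RESIDUAL after the deficiency cut (rev 7): line-free rigid skew stalled tails that are EITHER unclean
infinitely often (INTERFERENCE) OR of differential shade `μ̃ ≡ 0` from `N` on and, from some `N₁ ≥ N` on, clean AND IN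
THE FLAT MONOMIAL REGIME — at every time `≥ N₁` some `μ_P`-minimiser's cone is a young monomial `ρ·u^S` EVERY young
letter of which carries exactly its share `μ_{P,D_i} = S_i/a₀`: the cone is the boundary monomial of the unit,
Kawanoue–Matsuki's MONOMIAL CASE PROPER (`μ̃ = 0`, `τ = 1`) of the hypersurface `Z^q + F(u₀,u₁,u₂)` —
ambient dimension
FOUR, under forced point blow-ups (their §5 treats ambient dimension three). -/
def NoFlatRegimeSkewStalledTailsDeep : Prop :=
  ∀ p : ℕ, p.Prime → ∀ e : ℕ, 2 ≤ e → ∀ (K : Type) [Field K] [CharP K p] [PerfectField K] [DecidableEq K]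
    (s₀ : State (Fin 3) K), IsRoot (p ^ e) s₀ → ∀ W : ForcedWalk (p ^ e) s₀, (∀ i, 1 ≤ (W.st i).shade) →
    ∀ N : ℕ, (∀ t, N ≤ t → (W.st (t + 1)).shade = (W.st t).shade) →
    (∀ t, N ≤ t → ordZero (W.st t).F ≠ ((p ^ e : ℕ) : ℕ∞)) →
    (∀ M : ℕ, ∃ t, M ≤ t ∧ StaysOnNewest W t) → (∀ M : ℕ, ∃ t, M ≤ t ∧ W.b t ≠ 0) →
    (∀ (k : Fin 3) (N' : ℕ), ∃ t, N' ≤ t ∧ (W.j t = k ∨ W.b t k ≠ 0)) →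
    (∀ t, N ≤ t → (ifp W (t + 1)).muTilde (p ^ e) = (ifp W t).muTilde (p ^ e)) →
    (∀ t, N ≤ t → VertexLawEqAt W t) → (∀ t, N ≤ t → OriginLawAt W t) →
    (∀ (s : ℕ) (c : Fin 3 → K), ¬ ContactLineFrom W s c) →
    ((∀ N₁ : ℕ, N ≤ N₁ → ∃ t, N₁ ≤ t ∧ ¬ CleanAt W t) ∨
      (∃ N₁ : ℕ, N ≤ N₁ ∧ (∀ t, N ≤ t → (ifp W t).muTilde (p ^ e) = 0) ∧ (∀ t, N₁ ≤ t → CleanAt W t) ∧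
        ∀ t, N₁ ≤ t → FlatMonomialAt W t)) → False

/-- Sub-class direction: the flat-regime residual is implied by the monomial-regime residual (a flat regime is a
regime). [folklore] -/
theorem flat_of_monomialRegime (h : NoMonomialRegimeSkewStalledTailsDeep) : NoFlatRegimeSkewStalledTailsDeep := by
  intro p hp e he K _ _ _ _ s₀ hs W hsh N hplat hexc hS hT hskew hstall hrig horig hlf hdisj
  refine h p hp e he K s₀ hs W hsh N hplat hexc hS hT hskew hstall hrig horig hlf ?_
  rcases hdisj with hI | ⟨N₁, hN₁, -, hcl, hflat⟩
  · exact Or.inl hI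
  · exact Or.inr ⟨N₁, hN₁, hcl, fun t ht => youngMonomialAt_of_flatMonomialAt W t (hflat t ht)⟩

/-- **EXACT RE-LOCATION**: monomial regime ⟸ flat regime.  A clean monomial regime from `N₁` on a skew stalled tail is
flat from some `T ≥ N₁` (`eventually_flat`) and has `μ̃ ≡ 0` from `N` (`muTilde_eq_zero_of_regime`). [folklore] -/
theorem monomialRegime_of_flat (h : NoFlatRegimeSkewStalledTailsDeep) : NoMonomialRegimeSkewStalledTailsDeep := by
  intro p hp e he K _ _ _ _ s₀ hs W hsh N hplat hexc hS hT hskew hstall hrig horig hlf hdisj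
  rcases hdisj with hI | ⟨N₁, hN₁, hcl, hreg⟩
  · exact h p hp e he K s₀ hs W hsh N hplat hexc hS hT hskew hstall hrig horig hlf (Or.inl hI)
  · obtain ⟨T, hTle, hflat⟩ := eventually_flat hp hs W N₁ (fun t ht => hstall t (le_trans hN₁ ht)) hcl
      (hreg N₁ le_rfl) hskew
    exact h p hp e he K s₀ hs W hsh N hplat hexc hS hT hskew hstall hrig horig hlf
      (Or.inr ⟨T, le_trans hN₁ hTle, muTilde_eq_zero_of_regime hp hs W N N₁ hN₁ hstall hcl (hreg N₁ le_rfl) hskew,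
        fun t ht => hcl t (le_trans hTle ht), hflat⟩)

/-- `monomialRegime_iff_flat`: Auxiliary step of this node's calculus, VERBATIM from the lens file (see the module
docstring); the statement is its type. [folklore] -/
theorem monomialRegime_iff_flat : NoMonomialRegimeSkewStalledTailsDeep ↔ NoFlatRegimeSkewStalledTailsDeep :=
  ⟨flat_of_monomialRegime, monomialRegime_of_flat⟩

/-- The rev-2 line-free residual IS the flat-regime residual. [folklore] -/
theorem lineFree_iff_flat : NoLineFreeRigidSkewStalledTailsDeep ↔ NoFlatRegimeSkewStalledTailsDeep :=
  lineFree_iff_monomialRegime.trans monomialRegime_iff_flat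

/-- The g19 skew residual ⟺ the flat-regime residual (hypothesis-free). [folklore] -/
theorem skew_iff_flat : CoefficientCut.NoSkewJointTailsDeep ↔ NoFlatRegimeSkewStalledTailsDeep :=
  skew_iff_monomialRegime.trans monomialRegime_iff_flat

/-- The rev-3 MONOMIAL LEAF `NoMonomialSkewStalledTailsDeep` (`μ̃ ≡ 0`) now CARRIES THE WHOLE RESIDUAL: the positive
on-cone leaf's clean part is empty, so `vertex-bound skew stalled ⟸ (μ̃ ≡ 0 leaf) ∧ (positive tails are interference)`.
Typed: the positive on-cone leaf is equivalent to its INTERFERENCE sub-leaf. -/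
def NoPositiveInterferenceSkewStalledTailsDeep : Prop :=
  ∀ p : ℕ, p.Prime → ∀ e : ℕ, 2 ≤ e → ∀ (K : Type) [Field K] [CharP K p] [PerfectField K] [DecidableEq K]
    (s₀ : State (Fin 3) K), IsRoot (p ^ e) s₀ → ∀ W : ForcedWalk (p ^ e) s₀, (∀ i, 1 ≤ (W.st i).shade) →
    ∀ N : ℕ, (∀ t, N ≤ t → (W.st (t + 1)).shade = (W.st t).shade) →
    (∀ t, N ≤ t → ordZero (W.st t).F ≠ ((p ^ e : ℕ) : ℕ∞)) →
    (∀ M : ℕ, ∃ t, M ≤ t ∧ StaysOnNewest W t) → (∀ M : ℕ, ∃ t, M ≤ t ∧ W.b t ≠ 0) →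
    (∀ (k : Fin 3) (N' : ℕ), ∃ t, N' ≤ t ∧ (W.j t = k ∨ W.b t k ≠ 0)) →
    (∀ t, N ≤ t → (ifp W (t + 1)).muTilde (p ^ e) = (ifp W t).muTilde (p ^ e)) →
    (∀ t, N ≤ t → VertexLawEqAt W t) → (∀ t, N ≤ t → OriginLawAt W t) →
    (∀ (s : ℕ) (c : Fin 3 → K), ¬ ContactLineFrom W s c) →
    (0 : WithTop ℚ) < (ifp W N).muTilde (p ^ e) → (∀ N₁ : ℕ, N ≤ N₁ → ∃ t, N₁ ≤ t ∧ ¬ CleanAt W t) → False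

/-- The NULL leaf: line-free rigid skew stalled tails of differential shade `μ̃ ≡ 0` from `N` on that are EITHER unclean
infinitely often OR eventually clean in the FLAT monomial regime (Kawanoue–Matsuki's monomial case `μ̃ = 0`). -/
def NoNullSkewStalledTailsDeep : Prop :=
  ∀ p : ℕ, p.Prime → ∀ e : ℕ, 2 ≤ e → ∀ (K : Type) [Field K] [CharP K p] [PerfectField K] [DecidableEq K]
    (s₀ : State (Fin 3) K), IsRoot (p ^ e) s₀ → ∀ W : ForcedWalk (p ^ e) s₀, (∀ i, 1 ≤ (W.st i).shade) →
    ∀ N : ℕ, (∀ t, N ≤ t → (W.st (t + 1)).shade = (W.st t).shade) →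
    (∀ t, N ≤ t → ordZero (W.st t).F ≠ ((p ^ e : ℕ) : ℕ∞)) →
    (∀ M : ℕ, ∃ t, M ≤ t ∧ StaysOnNewest W t) → (∀ M : ℕ, ∃ t, M ≤ t ∧ W.b t ≠ 0) →
    (∀ (k : Fin 3) (N' : ℕ), ∃ t, N' ≤ t ∧ (W.j t = k ∨ W.b t k ≠ 0)) →
    (∀ t, N ≤ t → (ifp W (t + 1)).muTilde (p ^ e) = (ifp W t).muTilde (p ^ e)) →
    (∀ t, N ≤ t → VertexLawEqAt W t) → (∀ t, N ≤ t → OriginLawAt W t) →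
    (∀ (s : ℕ) (c : Fin 3 → K), ¬ ContactLineFrom W s c) →
    (∀ t, N ≤ t → (ifp W t).muTilde (p ^ e) = 0) →
    ((∀ N₁ : ℕ, N ≤ N₁ → ∃ t, N₁ ≤ t ∧ ¬ CleanAt W t) ∨
      (∃ N₁ : ℕ, N ≤ N₁ ∧ (∀ t, N₁ ≤ t → CleanAt W t) ∧ ∀ t, N₁ ≤ t → FlatMonomialAt W t)) → False

/-- **EXACT SPLIT OF THE RESIDUAL BY THE SETTLED VALUE OF `μ̃`**: flat-regime residual `↔` (positive tails, which are
INTERFERENCE tails by `unclean_io_of_muTilde_pos`) `∧` (null tails: interference ∨ flat regime). [folklore] -/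
theorem flat_iff_positiveInterference_null :
    NoFlatRegimeSkewStalledTailsDeep ↔ NoPositiveInterferenceSkewStalledTailsDeep ∧ NoNullSkewStalledTailsDeep := by
  constructor
  · intro h
    refine ⟨fun p hp e he K _ _ _ _ s₀ hs W hsh N hplat hexc hS hT hskew hstall hrig horig hlf _ hI =>
        h p hp e he K s₀ hs W hsh N hplat hexc hS hT hskew hstall hrig horig hlf (Or.inl hI),
      fun p hp e he K _ _ _ _ s₀ hs W hsh N hplat hexc hS hT hskew hstall hrig horig hlf h0 hdisj =>
        h p hp e he K s₀ hs W hsh N hplat hexc hS hT hskew hstall hrig horig hlf ?_⟩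
    rcases hdisj with hI | ⟨N₁, hN₁, hcl, hflat⟩
    · exact Or.inl hI
    · exact Or.inr ⟨N₁, hN₁, h0, hcl, hflat⟩
  · rintro ⟨hP, hZ⟩ p hp e he K _ _ _ _ s₀ hs W hsh N hplat hexc hS hT hskew hstall hrig horig hlf hdisj
    by_cases h0 : (ifp W N).muTilde (p ^ e) = 0
    · refine hZ p hp e he K s₀ hs W hsh N hplat hexc hS hT hskew hstall hrig horig hlf
        (fun t ht => by rw [muTilde_eq_of_stall W hstall ht, h0]) ?_
      rcases hdisj with hI | ⟨N₁, hN₁, -, hcl, hflat⟩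
      · exact Or.inl hI
      · exact Or.inr ⟨N₁, hN₁, hcl, hflat⟩
    · have hpos : (0 : WithTop ℚ) < (ifp W N).muTilde (p ^ e) := lt_of_le_of_ne (muTilde_nonneg W N) (Ne.symm h0)
      rcases hdisj with hI | ⟨N₁, _, hnull, -, -⟩
      · exact hP p hp e he K s₀ hs W hsh N hplat hexc hS hT hskew hstall hrig horig hlf hpos hI
      · exact h0 (hnull N le_rfl)

/-- The positive-interference leaf restated through the law: its interference binder is REDUNDANT — a positive tail
IS an interference tail (`unclean_io_of_muTilde_pos`), so the leaf equals the bare POSITIVE leaf. -/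
def NoPositiveSkewStalledTailsDeep : Prop :=
  ∀ p : ℕ, p.Prime → ∀ e : ℕ, 2 ≤ e → ∀ (K : Type) [Field K] [CharP K p] [PerfectField K] [DecidableEq K]
    (s₀ : State (Fin 3) K), IsRoot (p ^ e) s₀ → ∀ W : ForcedWalk (p ^ e) s₀, (∀ i, 1 ≤ (W.st i).shade) →
    ∀ N : ℕ, (∀ t, N ≤ t → (W.st (t + 1)).shade = (W.st t).shade) →
    (∀ t, N ≤ t → ordZero (W.st t).F ≠ ((p ^ e : ℕ) : ℕ∞)) →
    (∀ M : ℕ, ∃ t, M ≤ t ∧ StaysOnNewest W t) → (∀ M : ℕ, ∃ t, M ≤ t ∧ W.b t ≠ 0) →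
    (∀ (k : Fin 3) (N' : ℕ), ∃ t, N' ≤ t ∧ (W.j t = k ∨ W.b t k ≠ 0)) →
    (∀ t, N ≤ t → (ifp W (t + 1)).muTilde (p ^ e) = (ifp W t).muTilde (p ^ e)) →
    (∀ t, N ≤ t → VertexLawEqAt W t) → (∀ t, N ≤ t → OriginLawAt W t) →
    (∀ (s : ℕ) (c : Fin 3 → K), ¬ ContactLineFrom W s c) →
    (0 : WithTop ℚ) < (ifp W N).muTilde (p ^ e) → False

/-- `positiveInterference_iff_positive`: Auxiliary step of this node's calculus, VERBATIM from the lens file (see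
the module docstring); the statement is its type. [folklore] -/
theorem positiveInterference_iff_positive :
    NoPositiveInterferenceSkewStalledTailsDeep ↔ NoPositiveSkewStalledTailsDeep := by
  constructor
  · intro h p hp e he K _ _ _ _ s₀ hs W hsh N hplat hexc hS hT hskew hstall hrig horig hlf hpos
    exact h p hp e he K s₀ hs W hsh N hplat hexc hS hT hskew hstall hrig horig hlf hpos
      (unclean_io_of_muTilde_pos p hp e he K s₀ hs W hsh N hplat hexc hS hT hskew hstall hrig horig hlf hpos)
  · intro h p hp e he K _ _ _ _ s₀ hs W hsh N hplat hexc hS hT hskew hstall hrig horig hlf hpos _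
    exact h p hp e he K s₀ hs W hsh N hplat hexc hS hT hskew hstall hrig horig hlf hpos

end Classes

end Summit.ResolutionOfSingularities.ResolutionOfSingularities.Theorems.StallVertex
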